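import Summits.CriticalPhenomena.PercolationContinuityZ3.Theorems.PercNearOneGluingNoHeavyLowerTailSahiSymCubeFiveFive
import Summits.CriticalPhenomena.PercolationContinuityZ3.Theorems.PercNearOneGluingNoHeavyLowerTailSahiSymCubeFive6A
import Summits.CriticalPhenomena.PercolationContinuityZ3.Theorems.PercNearOneGluingNoHeavyLowerTailSahiSymCubeFive6B
import Summits.CriticalPhenomena.PercolationContinuityZ3.Theorems.PercNearOneGluingNoHeavyLowerTailSahiSymCubeFive6C
import Summits.CriticalPhenomena.PercolationContinuityZ3.Theorems.PercNearOneGluingNoHeavyLowerTailSahiSymCubeFive6D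
import Summits.CriticalPhenomena.PercolationContinuityZ3.Theorems.PercNearOneGluingNoHeavyLowerTailSahiSymCubeFive6E
import Summits.CriticalPhenomena.PercolationContinuityZ3.Theorems.PercNearOneGluingNoHeavyLowerTailSahiSymCubeFive6F
import Summits.CriticalPhenomena.PercolationContinuityZ3.Theorems.PercNearOneGluingNoHeavyLowerTailSahiSymCubeFive6G

/-!
# SAHI'S `C₆` ON THE CUBE `{0,1}^5` FOR EVERY PRODUCT MEASURE (Lean): assembly of the symmetry-reduced coloured-antichain check of order 6

Support file (cell `prim-sahi`, seat `prim-sahi-typer` gen 29; `--supports stmt-CriticalPhenomena-4575`).  Pure proofs; closure = standard axioms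
+ the `native_decide` axioms of the seven computational chunks …`SahiSymCubeFive6A–G` (1 532 order-6 digit tests, one coloured antichain per
orbit of `S_5 × S_6`, against `140 834` restricted-growth colourings / `53 220` axis representatives of the cell's external census) + those behind
…`SahiSymCubeFiveFive` (orders `≤ 5`).

* `symCheck_five_six : symCheck 5 6 41 = true`;
* **`sahiPositive_bernoulliWeight_six_fin_five`**: `SahiPositive (bernoulliWeight p) 6` for every `p : Fin 5 → [0,1]` (Sahi's `C₆` for five
  independent coins); `sahiC6_cube_five` — events form; `sahiPositive_bernoulliWeight_fin_five_of_le_six` — every order `n ≤ 6`. [this work]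
-/

namespace Summit.CriticalPhenomena.PercolationContinuityZ3.Theorems.SahiSymCube

open Literature.Combinatorics.Sahi2008
open Literature.Probability.Percolation.DecisionTree (ind)

/-- **The order-6 symmetry-reduced check on `{0,1}^5` passes** (assembled from the seven computational chunks). [this work] -/
theorem symCheck_five_six : symCheck 5 6 41 = true :=
  symCheck_of_from (symCheckFrom_of_range symCheck_five_6_chunkA (symCheckFrom_of_range symCheck_five_6_chunkB
    (symCheckFrom_of_range symCheck_five_6_chunkC (symCheckFrom_of_range symCheck_five_6_chunkD
    (symCheckFrom_of_range symCheck_five_6_chunkE (symCheckFrom_of_range symCheck_five_6_chunkF symCheck_five_6_chunkG))))))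

/-- **SAHI'S `C₆` FOR FIVE INDEPENDENT COINS**: `SahiPositive (bernoulliWeight p) 6` for every `p : Fin 5 → [0,1]`. [this work] -/
theorem sahiPositive_bernoulliWeight_six_fin_five (p : Fin 5 → unitInterval) : SahiPositive (bernoulliWeight p) 6 :=
  sahiPositive_of_symCheck (n := 4) symCheck_five_six p fun _ _ hk => sahiPositive_bernoulliWeight_fin_five_of_le_five p hk

/-- **Sahi's `C₆` on `{0,1}^5`, events form**: `E₆(μ_p; A₀, …, A₅) ≥ 0` for increasing events under every product measure. [this work] -/
theorem sahiC6_cube_five (p : Fin 5 → unitInterval) {A : Fin 6 → Set (Set (Fin 5))} (hA : ∀ i, IsUpperSet (A i)) :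
    0 ≤ sahiE (bernoulliWeight p) 6 (fun i => ind (A i)) :=
  sahiE_ind_nonneg_of_symCheck (n := 4) symCheck_five_six p (fun _ _ hk => sahiPositive_bernoulliWeight_fin_five_of_le_five p hk) hA

/-- **Sahi's conjecture at every order `n ≤ 6` for five independent coins.** [this work] -/
theorem sahiPositive_bernoulliWeight_fin_five_of_le_six (p : Fin 5 → unitInterval) {n : ℕ} (hn : n ≤ 6) :
    SahiPositive (bernoulliWeight p) n := by
  rcases Nat.lt_or_ge n 6 with h | h
  · exact sahiPositive_bernoulliWeight_fin_five_of_le_five p (by omega)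
  · have : n = 6 := le_antisymm hn h
    subst this
    exact sahiPositive_bernoulliWeight_six_fin_five p

end Summit.CriticalPhenomena.PercolationContinuityZ3.Theorems.SahiSymCube
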